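import Summits.QuantumFields.YangMills.Theorems.FlatTubeReductionCoreTransferMomentsSq
import HarnessLib

/-!
# (A1-a) THE SLOW CAUCHY–SCHWARZ STEP: `(∫ φ·X)² ≤ (∫ φ²ρ̄)·(∫ X²/ρ̄)` for a positive kernel `ρ̄`, and the division form of the squared core-transfer defect
# `(I − K_Pρ̄)²/ρ̄ ≤ A·K_P·D + E·K_P²·ρ̄` — the two real-analysis moves of the assembly (A1) of `stub_hODpot_A`
# (memo `Cruxes/NearFlatRatioLaw/Lines/ratepack-v7-moments-g18.md` §5 (A1); route `FlatTubeReduction`, crux K1 `NearFlatRatioLaw` stmt-QuantumFields-24720, line «ratepack_v2» skeleton v6;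
# seat `ym-line-ftr-p1` g18; R2b1 RECORD rung — no summit statement is proved here)

WHY.  The core part of the transfer of a BO function is `K_core(U) = Z⁻¹∫ φ(u)·I(U;u) du`; its quasimode defect against `Z⁻¹c_qM(x')∫φρ̄` is `Z⁻¹∫φ(u)(I(U;u) − K_Pρ̄(u',u))du`.
With `…CoreTransferMomentsCS.colour_fpFibreTransfer_defect_sq_le_moments` in the form `(I − K_Pρ̄)² ≤ A·K_Pρ̄·D + E·(K_Pρ̄)²` (`D = Σ_mγ_m²Y_m`), Cauchy–Schwarz against the positive
one-site kernel `ρ̄` keeps `φ²` paired with `ρ̄` (so that `orbitDist u` stays with `φ(u)²` — the potential) and puts the moments on the other factor: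
* ★ `sq_integral_mul_le_weighted_div` — `(∫ φX)² ≤ (∫ φ²ρ̄)(∫ X²/ρ̄)` for measurable bounded `φ, X` and measurable `ρ̄` with `0 < c ≤ ρ̄ ≤ C` (finite measure);
* `sq_div_le_of_sq_le` — pointwise: `(I − K_Pρ̄)² ≤ A K_Pρ̄ D + E (K_Pρ̄)²`, `ρ̄ > 0` ⇒ `(I − K_Pρ̄)²/ρ̄ ≤ A K_P D + E K_P² ρ̄`.
HONEST FRAMING: elementary real analysis for a stub of the CONDITIONAL reduction route R2b1 (rate twin); femto rung R2b1 (RECORD label); not infinite volume, not a mass gap, not Clay.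
No defs, no named facts, no `sorry`.
-/

set_option autoImplicit false

noncomputable section

open MeasureTheory Filter Topology Real
open scoped BigOperators

namespace Summit.QuantumFields.YangMills.Theorems.FemtoTransferGap.TwoLattice.ConstTube

/-- ★ **Slow Cauchy–Schwarz against a positive kernel**: `(∫ φ·X)² ≤ (∫ φ²·ρ̄)·(∫ X²/ρ̄)` on a finite measure space, for bounded measurable `φ, X` and measurable `ρ̄` with
`0 < c ≤ ρ̄ ≤ C`. [folklore] -/
theorem sq_integral_mul_le_weighted_div {Y : Type*} [MeasurableSpace Y] (μ : Measure Y) [IsFiniteMeasure μ] {φ X ρ : Y → ℝ}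
    (hφm : Measurable φ) (hXm : Measurable X) (hρm : Measurable ρ) {Cφ CX c C : ℝ} (hφb : ∀ y, |φ y| ≤ Cφ) (hXb : ∀ y, |X y| ≤ CX) (hc : 0 < c)
    (hρc : ∀ y, c ≤ ρ y) (hρC : ∀ y, ρ y ≤ C) :
    (∫ y, φ y * X y ∂μ) ^ 2 ≤ (∫ y, φ y ^ 2 * ρ y ∂μ) * ∫ y, X y ^ 2 / ρ y ∂μ := by
  have hρ0 : ∀ y, 0 ≤ ρ y := fun y => hc.le.trans (hρc y)
  have hρne : ∀ y, ρ y ≠ 0 := fun y => (hc.trans_le (hρc y)).ne'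
  -- `J = ρ`, `f = φ`, `g = X/ρ`
  have hff : Integrable (fun y => ρ y * φ y ^ 2) μ := by
    refine integrable_of_measurable_abs_le μ (hρm.mul (hφm.pow_const 2)) (C := C * Cφ ^ 2) fun y => ?_
    rw [abs_mul, abs_of_nonneg (hρ0 y), abs_of_nonneg (sq_nonneg _)]
    have h1 : φ y ^ 2 ≤ Cφ ^ 2 := by rw [← sq_abs]; exact pow_le_pow_left₀ (abs_nonneg _) (hφb y) 2
    exact mul_le_mul (hρC y) h1 (sq_nonneg _) ((hρ0 y).trans (hρC y))
  have hfg : Integrable (fun y => ρ y * (φ y * (X y / ρ y))) μ := by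
    have e : (fun y => ρ y * (φ y * (X y / ρ y))) = fun y => φ y * X y := by funext y; field_simp [hρne y]
    rw [e]
    refine integrable_of_measurable_abs_le μ (hφm.mul hXm) (C := Cφ * CX) fun y => ?_
    rw [abs_mul]; exact mul_le_mul (hφb y) (hXb y) (abs_nonneg _) ((abs_nonneg _).trans (hφb y))
  have hgg : Integrable (fun y => ρ y * (X y / ρ y) ^ 2) μ := by
    have e : (fun y => ρ y * (X y / ρ y) ^ 2) = fun y => X y ^ 2 / ρ y := by funext y; field_simp [hρne y]
    rw [e]
    refine integrable_of_measurable_abs_le μ ((hXm.pow_const 2).div hρm) (C := CX ^ 2 / c) fun y => ?_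
    rw [abs_div, abs_of_nonneg (sq_nonneg _), abs_of_pos (hc.trans_le (hρc y))]
    have h1 : X y ^ 2 ≤ CX ^ 2 := by rw [← sq_abs]; exact pow_le_pow_left₀ (abs_nonneg _) (hXb y) 2
    exact div_le_div₀ (sq_nonneg _) h1 hc (hρc y)
  have h := sq_integral_mul_le μ hρ0 hff hfg hgg
  have e1 : (fun y => ρ y * (φ y * (X y / ρ y))) = fun y => φ y * X y := by funext y; field_simp [hρne y]
  have e2 : (fun y => ρ y * φ y ^ 2) = fun y => φ y ^ 2 * ρ y := by funext y; ring
  have e3 : (fun y => ρ y * (X y / ρ y) ^ 2) = fun y => X y ^ 2 / ρ y := by funext y; field_simp [hρne y]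
  rw [e1, e2, e3] at h
  exact h

/-- `(I − K_Pρ̄)² ≤ A·K_Pρ̄·D + E·(K_Pρ̄)²` with `ρ̄ > 0` gives `(I − K_Pρ̄)²/ρ̄ ≤ A·K_P·D + E·K_P²·ρ̄`. [folklore] -/
theorem sq_div_le_of_sq_le {I KP ρ A D E : ℝ} (hρ : 0 < ρ) (h : (I - KP * ρ) ^ 2 ≤ A * (KP * ρ) * D + E * (KP * ρ) ^ 2) :
    (I - KP * ρ) ^ 2 / ρ ≤ A * KP * D + E * KP ^ 2 * ρ := by
  rw [div_le_iff₀ hρ]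
  nlinarith [h]


/-! ## Appended (g18, 03:20Z): the slow integration of the squared defect — `(∫φI − K_P∫φρ̄)² ≤ (∫φ²ρ̄)(A·K_P·∫D + E·K_P²·∫ρ̄)` -/

/-- ★★ **SLOW INTEGRATION OF THE SQUARED DEFECT**: on a finite measure space, for bounded measurable `φ, I, D`, measurable `ρ̄` with `0 < c ≤ ρ̄ ≤ C`, a constant
`K_P ≥ 0`, reals `A, E` and the pointwise bound `(I − K_Pρ̄)² ≤ A·K_Pρ̄·D + E·(K_Pρ̄)²`:
`(∫φI − K_P∫φρ̄)² ≤ (∫φ²ρ̄)·(A·K_P·∫D + E·K_P²·∫ρ̄)`. [folklore] -/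
theorem sq_slow_defect_le {Y : Type*} [MeasurableSpace Y] (μ : Measure Y) [IsFiniteMeasure μ] {φ I D ρ : Y → ℝ}
    (hφm : Measurable φ) (hIm : Measurable I) (hDm : Measurable D) (hρm : Measurable ρ) {Cφ CI CD c C : ℝ}
    (hφb : ∀ y, |φ y| ≤ Cφ) (hIb : ∀ y, |I y| ≤ CI) (hDb : ∀ y, |D y| ≤ CD) (hc : 0 < c) (hρc : ∀ y, c ≤ ρ y) (hρC : ∀ y, ρ y ≤ C)
    {KP A E : ℝ} (hKP : 0 ≤ KP) (hpt : ∀ y, (I y - KP * ρ y) ^ 2 ≤ A * (KP * ρ y) * D y + E * (KP * ρ y) ^ 2) :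
    (∫ y, φ y * I y ∂μ - KP * ∫ y, φ y * ρ y ∂μ) ^ 2 ≤ (∫ y, φ y ^ 2 * ρ y ∂μ) * (A * KP * ∫ y, D y ∂μ + E * KP ^ 2 * ∫ y, ρ y ∂μ) := by
  have hρ0 : ∀ y, 0 ≤ ρ y := fun y => hc.le.trans (hρc y)
  have hρpos : ∀ y, 0 < ρ y := fun y => hc.trans_le (hρc y)
  have hCφ : ∀ y, 0 ≤ Cφ := fun y => (abs_nonneg _).trans (hφb y)
  -- integrability of the bounded measurable pieces
  have hφI : Integrable (fun y => φ y * I y) μ :=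
    integrable_of_measurable_abs_le μ (hφm.mul hIm) (C := Cφ * CI) fun y => by rw [abs_mul]; exact mul_le_mul (hφb y) (hIb y) (abs_nonneg _) (hCφ y)
  have hφρ : Integrable (fun y => φ y * ρ y) μ :=
    integrable_of_measurable_abs_le μ (hφm.mul hρm) (C := Cφ * C) fun y => by
      rw [abs_mul, abs_of_nonneg (hρ0 y)]; exact mul_le_mul (hφb y) (hρC y) (hρ0 y) (hCφ y)
  have hDint : Integrable D μ := integrable_of_measurable_abs_le μ hDm hDb
  have hρint : Integrable ρ μ := integrable_of_measurable_abs_le μ hρm (C := C) fun y => by rw [abs_of_nonneg (hρ0 y)]; exact hρC y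
  -- `∫φI − K_P∫φρ̄ = ∫ φ·(I − K_Pρ̄)`
  set X : Y → ℝ := fun y => I y - KP * ρ y with hX
  have hXm : Measurable X := hIm.sub (hρm.const_mul KP)
  have hXb : ∀ y, |X y| ≤ CI + KP * C := fun y => by
    rw [hX]; dsimp only
    calc |I y - KP * ρ y| ≤ |I y| + |KP * ρ y| := abs_sub _ _
      _ ≤ CI + KP * C := add_le_add (hIb y) (by rw [abs_of_nonneg (mul_nonneg hKP (hρ0 y))]; exact mul_le_mul_of_nonneg_left (hρC y) hKP)
  have hdiff : ∫ y, φ y * I y ∂μ - KP * ∫ y, φ y * ρ y ∂μ = ∫ y, φ y * X y ∂μ := by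
    rw [← integral_const_mul, ← integral_sub hφI (hφρ.const_mul KP)]
    refine integral_congr_ae (ae_of_all _ fun y => ?_)
    rw [hX]; dsimp only; ring
  rw [hdiff]
  -- Cauchy–Schwarz against `ρ̄`
  have hcs := sq_integral_mul_le_weighted_div μ hφm hXm hρm hφb hXb hc hρc hρC
  -- `∫ X²/ρ̄ ≤ A·K_P·∫D + E·K_P²·∫ρ̄`
  have hXdiv : ∀ y, X y ^ 2 / ρ y ≤ A * KP * D y + E * KP ^ 2 * ρ y := fun y => sq_div_le_of_sq_le (hρpos y) (hpt y)
  have hrhs : Integrable (fun y => A * KP * D y + E * KP ^ 2 * ρ y) μ := (hDint.const_mul _).add (hρint.const_mul _)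
  have hXdivint : Integrable (fun y => X y ^ 2 / ρ y) μ := by
    refine integrable_of_measurable_abs_le μ ((hXm.pow_const 2).div hρm) (C := (CI + KP * C) ^ 2 / c) fun y => ?_
    rw [abs_div, abs_of_nonneg (sq_nonneg _), abs_of_pos (hρpos y)]
    have h1 : X y ^ 2 ≤ (CI + KP * C) ^ 2 := by rw [← sq_abs]; exact pow_le_pow_left₀ (abs_nonneg _) (hXb y) 2
    exact div_le_div₀ (sq_nonneg _) h1 hc (hρc y)
  have h2 : ∫ y, X y ^ 2 / ρ y ∂μ ≤ A * KP * ∫ y, D y ∂μ + E * KP ^ 2 * ∫ y, ρ y ∂μ := by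
    have h := integral_mono hXdivint hrhs hXdiv
    rw [integral_add (hDint.const_mul _) (hρint.const_mul _), integral_const_mul, integral_const_mul] at h
    exact h
  have h0 : 0 ≤ ∫ y, φ y ^ 2 * ρ y ∂μ := integral_nonneg fun y => mul_nonneg (sq_nonneg _) (hρ0 y)
  exact hcs.trans (mul_le_mul_of_nonneg_left h2 h0)

end Summit.QuantumFields.YangMills.Theorems.FemtoTransferGap.TwoLattice.ConstTube

end
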